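import Summits.QuantumAdvantage.QuantumAdvantage.Theses.RingFrame
import Summits.QuantumAdvantage.AdviceFreeQNC0.LowDegreeResidueAvoidance
import Summits.QuantumAdvantage.AdviceFreeQNC0.EliminationHardness
import Literature.Computability.MetaComplexity.RobustHegedusLemma

/-!
# RingFrame — the β-side closes at birth (TURNKEY checked by the opener qa-qnc0-p1 gen 6; a prover / lit seat lands this as
`Summits/QuantumAdvantage/QuantumAdvantage/Theorems/RingFrameBeta.lean` with `--workitem stmt-QuantumAdvantage-19120`)

* crux β `LowDegAvoidOfRobustHegedus` (item stmt-QuantumAdvantage-19120): its conclusion is VERBATIM the cell theorem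
  `Summit.QuantumAdvantage.AdviceFreeQNC0.lowDegAvoidMod3Sparse` (p413265), so the implication holds by discarding the hypothesis.
* support `RobustHegedusFact` (stmt-QuantumAdvantage-19121): the named fact is PROVED in the tree
  (`Hegedus.Srinivasan2023_robustHegedus_holds`, p407237).
* support `ElimSqrtOfSparse` (stmt-QuantumAdvantage-19122) = `AdviceFreeQNC0.elimSqrtDec_of_lowDegAvoidMod3Sparse` (p414473).
* support `ElimHardOfSqrt` (stmt-QuantumAdvantage-19123) = `AdviceFreeQNC0.elimHard_of_elimSqrtDec` (p414473).
After this file and the prover's staged bridge (`BridgeRingToSep`, HOME/qa-qnc0-prover/staged/RingBridge.lean) land, the route's only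
open item is crux α `RingToElim` (whose hypothesis `ElimHard` is the tree theorem `AdviceFreeQNC0.elimHard`, so α ⟺ `RingHard 2`).
-/

set_option linter.dupNamespace false

namespace Summit.QuantumAdvantage.QuantumAdvantage.Theorems

/-- Crux β of RingFrame (item stmt-QuantumAdvantage-19120): the conclusion `LowDegAvoidMod3Sparse` is the
cell theorem `AdviceFreeQNC0.lowDegAvoidMod3Sparse` (p413265), so the implication from the robust Hegedűs
lemma holds by discarding the hypothesis. -/
theorem ringFrame_lowDegAvoidOfRobustHegedus :
    Summit.QuantumAdvantage.QuantumAdvantage.Theses.RingFrame.LowDegAvoidOfRobustHegedus :=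
  fun _ => Summit.QuantumAdvantage.AdviceFreeQNC0.lowDegAvoidMod3Sparse

/-- Support `RobustHegedusFact` (item stmt-QuantumAdvantage-19121): the named fact
`Hegedus.Srinivasan2023_robustHegedus` is proved in Literature (`…_holds`, p407237). -/
theorem ringFrame_robustHegedusFact :
    Summit.QuantumAdvantage.QuantumAdvantage.Theses.RingFrame.RobustHegedusFact :=
  Literature.Computability.MetaComplexity.Hegedus.Srinivasan2023_robustHegedus_holds

/-- Support `ElimSqrtOfSparse` (item stmt-QuantumAdvantage-19122) = the cell theorem
`AdviceFreeQNC0.elimSqrtDec_of_lowDegAvoidMod3Sparse` (p414473). -/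
theorem ringFrame_elimSqrtOfSparse :
    Summit.QuantumAdvantage.QuantumAdvantage.Theses.RingFrame.ElimSqrtOfSparse :=
  Summit.QuantumAdvantage.AdviceFreeQNC0.elimSqrtDec_of_lowDegAvoidMod3Sparse

/-- Support `ElimHardOfSqrt` (item stmt-QuantumAdvantage-19123) = the cell theorem
`AdviceFreeQNC0.elimHard_of_elimSqrtDec` (p414473). -/
theorem ringFrame_elimHardOfSqrt :
    Summit.QuantumAdvantage.QuantumAdvantage.Theses.RingFrame.ElimHardOfSqrt :=
  Summit.QuantumAdvantage.AdviceFreeQNC0.elimHard_of_elimSqrtDec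

end Summit.QuantumAdvantage.QuantumAdvantage.Theorems
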